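import Summits.Ventures.HSemireg.WedgeHankelFaces
import Summits.Ventures.HSemireg.WedgeHankelBox

/-!
# Venture HSemireg — HANKEL RANK ONE: `rank H_1(q) ≤ 1 ⟺ q` is an exponential `Aλ^•` or the point `c·δ_m` on `{0, …, m}`
# (the converse of the pure faces: a class of Hankel rank `≤ 1` IS pure, the point, or zero)

HONEST FRAMING. Part of the Lean index of the computation cell `pub-hsemireg` (seat p10 gen 14, Sunday typer «UNIFORM-IN-n»).
LINEAR ALGEBRA OF HANKEL (catalecticant) MATRICES over a field ONLY (plus th-7's recursion for `w_m(q)`): no variety, no cohomology theory,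
no sheaf, no Ext group and no semiregularity map is constructed here; nothing here says that HC / HC_CM / HC_AV holds; no Literature fact is
declared or used.  Custodian versions cited: theory/FORMULA-N.md PART A §2.6 THEOREM H and its KRONECKER DICTIONARY («ρ = 1 pure (line bundle /
𝒪 / pt)»); STRUCTURE.md v1.0-SIGNED 9b196a05977dd067 §1.1 C15.  The dictionary (`A·exp(λΘ)` ↦ `Aλ^j`, `pt` ↦ `δ_m`) is QUOTED, never asserted.

WHAT IS IN THE TREE.  The two rank-`1` faces have Hankel rank `1` (`WedgeHankelFaces.rank_hankel1_expSeq`; the point via THEOREM T / C7) and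
their kernels are NAMED (gen 13 C6/C7: the frame ideals); gen 13 C3 proved «no `1`-form kills `w_m(q)` ⟺ `rank H_1(q) = 2`» and left the
CONVERSE («a class killed by a `1`-form is pure or zero») open.  THIS FILE proves the converse at the level of sequences:
* §1 `w_m(q)` and `H_k(q)` (`k ≤ m`) only see `q_0, …, q_m` (`w_eq_of_agree`, `hankel1_eq_of_agree`).
* §2 `rank H_1(q) ≤ 1` ⇒ every `2 × 2` minor vanishes: **`q_s q_{t+1} = q_t q_{s+1}`** for `s, t < m` (`minor_eq_zero_of_rank_le_one`; an invertible
  `2 × 2` submatrix would have rank `2`).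
* §3 **THE RANK-ONE CLASSIFICATION `rank_hankel1_one_le_one_iff`** (`m ≥ 1`): `rank H_1(q) ≤ 1 ⟺ (∃ A λ, q_j = Aλ^j for all j ≤ m) ∨ (q_j = 0 for all
  j < m)` — an exponential (possibly `A = 0`) or the point `q_m·δ_m`; the converse by `H = column ⊗ row` (`Matrix.rank_vecMulVec_le`).
* §4 in th-7's model: **`w_eq_expSeq_or_point_of_rank_le_one`**: `rank H_1(q) ≤ 1 ⇒ w_m(q) = w_m(Aλ^•)` for some `A, λ`, or `w_m(q) = w_m(0,…,0,q_m)`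
  (591's `expSeq`, 585's `ppSeq m 0 c`) — so by gen 13 C3/C6/C7 a class killed by a non-zero `1`-form is pure, the point, or zero, and its kernel in
  every degree is the ideal of its frame (the chained corollary is the next leaf).
Namespace `Summit.Ventures.HSemireg.Wedge.HankelRankOne` (new); new names only.
-/

open Module

namespace Summit.Ventures.HSemireg.Wedge.HankelRankOne

open Summit.Ventures.HSemireg.Wedge Summit.Ventures.HSemireg.Wedge.Hankel Summit.Ventures.HSemireg.Wedge.HankelFaces
  Summit.Ventures.HSemireg.Wedge.HankelBox

variable (K : Type*) [Field K]

/-! ## §1. Only `q_0, …, q_m` matter -/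

/-- th-7's class `w_j(q)` depends only on `q_0, …, q_j`. -/
theorem w_eq_of_agree {n : ℕ} : ∀ (j : ℕ) {q q' : ℕ → K}, (∀ i ≤ j, q i = q' i) → w K n j q = w K n j q'
  | 0, q, q', h => by rw [w, w, h 0 le_rfl]
  | j + 1, q, q', h => by
    rw [w, w, w_eq_of_agree j (q := q) (q' := q') fun i hi => h i (by omega),
      w_eq_of_agree j (q := shift K q) (q' := shift K q') fun i hi => h (i + 1) (by omega)]

variable {K} in
omit [Field K] in
/-- the Hankel matrix `H_k(q)` (`k ≤ m`) depends only on `q_0, …, q_m`. -/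
theorem hankel1_eq_of_agree {m k : ℕ} (hk : k ≤ m) {q q' : ℕ → K} (h : ∀ i ≤ m, q i = q' i) :
    hankel1 K m k q = hankel1 K m k q' := by
  ext i s
  simp only [hankel1, Matrix.of_apply]
  exact h _ (by have := i.isLt; have := s.isLt; omega)

/-! ## §2. Rank at most one kills the `2 × 2` minors -/

variable {K} in
/-- **`rank H_1(q) ≤ 1 ⇒ q_s q_{t+1} = q_t q_{s+1}`** for `s, t < m`: otherwise the `2 × 2` submatrix on columns `s, t` is invertible, of rank `2`. -/
theorem minor_eq_zero_of_rank_le_one {m : ℕ} {q : ℕ → K} (h : (hankel1 K m 1 q).rank ≤ 1) {s t : ℕ} (hs : s < m) (ht : t < m) :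
    q s * q (t + 1) = q t * q (s + 1) := by
  by_contra hne
  let c : Fin 2 → Fin (m + 1 - 1) := ![⟨s, by omega⟩, ⟨t, by omega⟩]
  let N : Matrix (Fin 2) (Fin 2) K := (hankel1 K m 1 q).submatrix (fun i => i) c
  have hdet : N.det = q s * q (t + 1) - q t * q (s + 1) := by
    rw [Matrix.det_fin_two]
    simp only [N, c, Matrix.submatrix_apply, hankel1, Matrix.of_apply, Matrix.cons_val_zero, Matrix.cons_val_one,
      Fin.val_zero, Fin.val_one, zero_add]
    ring
  have hunit : IsUnit N := by
    rw [Matrix.isUnit_iff_isUnit_det, hdet, isUnit_iff_ne_zero]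
    exact sub_ne_zero.mpr hne
  have h2 : N.rank = 2 := by rw [Matrix.rank_of_isUnit N hunit, Fintype.card_fin]
  have hle : N.rank ≤ (hankel1 K m 1 q).rank := Matrix.rank_submatrix_le _ _ _
  omega

/-! ## §3. The rank-one classification -/

variable {K} in
/-- `q_0 ≠ 0` and rank `≤ 1`: `q` is the exponential `q_0 · (q_1/q_0)^j` on `{0, …, m}`. -/
theorem eq_expSeq_of_rank_le_one {m : ℕ} {q : ℕ → K} (h : (hankel1 K m 1 q).rank ≤ 1) (h0 : q 0 ≠ 0) :
    ∀ j ≤ m, q j = q 0 * (q 1 / q 0) ^ j := by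
  intro j hj
  induction j with
  | zero => rw [pow_zero, mul_one]
  | succ j ih =>
    have hmin := minor_eq_zero_of_rank_le_one h (s := 0) (t := j) (by omega) (by omega)
    rw [zero_add] at hmin
    -- q 0 * q (j+1) = q j * q 1
    have e : q (j + 1) = q j * q 1 / q 0 := by field_simp; linear_combination hmin
    rw [e, ih (by omega), pow_succ]
    field_simp

variable {K} in
/-- `q_0 = 0` and rank `≤ 1`: `q_0 = ⋯ = q_{m−1} = 0` (the point `q_m · δ_m`, or zero). -/
theorem eq_zero_of_rank_le_one {m : ℕ} {q : ℕ → K} (h : (hankel1 K m 1 q).rank ≤ 1) (h0 : q 0 = 0) :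
    ∀ j < m, q j = 0 := by
  intro j
  induction j with
  | zero => exact fun _ => h0
  | succ j ih =>
    intro hj
    have hmin := minor_eq_zero_of_rank_le_one h (s := j) (t := j + 1) (by omega) hj
    rw [ih (by omega), zero_mul] at hmin
    -- 0 = q (j+1) * q (j+1)
    exact pow_eq_zero_iff (n := 2) two_ne_zero |>.mp (by rw [pow_two]; exact hmin.symm)

variable {K} in
/-- the Hankel matrix `H_1` of an exponential is `column ⊗ row`, of rank `≤ 1`. -/
theorem rank_hankel1_one_le_one_of_expSeq {m : ℕ} {q : ℕ → K} {A lam : K} (hq : ∀ j ≤ m, q j = A * lam ^ j) :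
    (hankel1 K m 1 q).rank ≤ 1 := by
  have e : hankel1 K m 1 q = Matrix.vecMulVec (fun i : Fin (1 + 1) => lam ^ (i : ℕ)) (fun s : Fin (m + 1 - 1) => A * lam ^ (s : ℕ)) := by
    ext i s
    rw [hankel1, Matrix.of_apply, Matrix.vecMulVec_apply, hq _ (by have := i.isLt; have := s.isLt; omega), pow_add]
    ring
  rw [e]
  exact Matrix.rank_vecMulVec_le _ _

variable {K} in
/-- the Hankel matrix `H_1` of a sequence vanishing below `m` is `column ⊗ row` (a single corner entry), of rank `≤ 1` (`m ≥ 1`). -/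
theorem rank_hankel1_one_le_one_of_zero {m : ℕ} (hm : 1 ≤ m) {q : ℕ → K} (hq : ∀ j < m, q j = 0) :
    (hankel1 K m 1 q).rank ≤ 1 := by
  have e : hankel1 K m 1 q = Matrix.vecMulVec (fun i : Fin (1 + 1) => if (i : ℕ) = 1 then q m else 0)
      (fun s : Fin (m + 1 - 1) => if (s : ℕ) + 1 = m then (1 : K) else 0) := by
    ext i s
    rw [hankel1, Matrix.of_apply, Matrix.vecMulVec_apply]
    have hi := i.isLt; have hs := s.isLt
    by_cases him : (i : ℕ) + (s : ℕ) = m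
    · rw [if_pos (by omega), if_pos (by omega), him, mul_one]
    · rw [hq _ (by omega)]
      by_cases hi1 : (i : ℕ) = 1
      · rw [if_pos hi1, if_neg (by omega), mul_zero]
      · rw [if_neg hi1, zero_mul]
  rw [e]
  exact Matrix.rank_vecMulVec_le _ _

/-- **THE RANK-ONE CLASSIFICATION (`m ≥ 1`): `rank H_1(q) ≤ 1 ⟺ (∃ A λ, q_j = Aλ^j for all j ≤ m) ∨ (q_j = 0 for all j < m)`** — on `{0, …, m}` a
sequence of Hankel rank `≤ 1` is an exponential (quoted: `A·exp(λΘ)`, `A = 0` allowed) or the point `q_m·δ_m`; every field. -/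
theorem rank_hankel1_one_le_one_iff {m : ℕ} (hm : 1 ≤ m) (q : ℕ → K) :
    (hankel1 K m 1 q).rank ≤ 1 ↔ (∃ A lam : K, ∀ j ≤ m, q j = A * lam ^ j) ∨ (∀ j < m, q j = 0) := by
  constructor
  · intro h
    by_cases h0 : q 0 = 0
    · exact Or.inr (eq_zero_of_rank_le_one h h0)
    · exact Or.inl ⟨q 0, q 1 / q 0, eq_expSeq_of_rank_le_one h h0⟩
  · rintro (⟨A, lam, hq⟩ | hq)
    · exact rank_hankel1_one_le_one_of_expSeq hq
    · exact rank_hankel1_one_le_one_of_zero hm hq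

/-- rank EXACTLY `1` (`m ≥ 1`): a non-zero exponential, or the point with `q_m ≠ 0`. -/
theorem rank_hankel1_one_eq_one_imp {m : ℕ} (hm : 1 ≤ m) {q : ℕ → K} (h : (hankel1 K m 1 q).rank = 1) :
    (∃ A lam : K, A ≠ 0 ∧ ∀ j ≤ m, q j = A * lam ^ j) ∨ ((∀ j < m, q j = 0) ∧ q m ≠ 0) := by
  have hne : hankel1 K m 1 q ≠ 0 := by
    intro hz; rw [hz, Matrix.rank_zero] at h; exact zero_ne_one h
  rcases (rank_hankel1_one_le_one_iff K hm q).mp h.le with ⟨A, lam, hq⟩ | hq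
  · refine Or.inl ⟨A, lam, ?_, hq⟩
    rintro rfl
    apply hne
    ext i s
    rw [hankel1, Matrix.of_apply, hq _ (by have := i.isLt; have := s.isLt; omega), zero_mul, Matrix.zero_apply]
  · refine Or.inr ⟨hq, fun hm0 => hne ?_⟩
    ext i s
    rw [hankel1, Matrix.of_apply, Matrix.zero_apply]
    have hi := i.isLt; have hs := s.isLt
    by_cases him : (i : ℕ) + (s : ℕ) = m
    · rw [him, hm0]
    · exact hq _ (by omega)

/-! ## §4. In th-7's model: the class is an exponential's or the point's -/

/-- an exponential on `{0, …, m}` gives the pure class: `w_m(q) = w_m(Aλ^•)` (591's `expSeq`). -/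
theorem w_eq_w_expSeq {m : ℕ} {q : ℕ → K} {A lam : K} (hq : ∀ j ≤ m, q j = A * lam ^ j) :
    w K m m q = w K m m (expSeq K A lam) :=
  w_eq_of_agree K m fun i hi => by rw [hq i hi, expSeq_apply]

/-- a sequence vanishing below `m` gives the point class: `w_m(q) = w_m(0, …, 0, q_m)` (585's `ppSeq m 0 c`; `m ≥ 1`). -/
theorem w_eq_w_ppSeq {m : ℕ} (hm : 1 ≤ m) {q : ℕ → K} (hq : ∀ j < m, q j = 0) :
    w K m m q = w K m m (ppSeq K m 0 (q m)) :=
  w_eq_of_agree K m fun i hi => by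
    rw [ppSeq]
    by_cases him : i = m
    · rw [him, if_pos rfl, if_neg (by omega), zero_add]
    · rw [hq i (by omega), if_neg him, ite_self, add_zero]

/-- **A CLASS OF HANKEL RANK `≤ 1` IS PURE, THE POINT, OR ZERO** (`m ≥ 1`): `rank H_1(q) ≤ 1 ⇒ w_m(q) = w_m(Aλ^•)` for some `A, λ`, or
`w_m(q) = w_m(0, …, 0, q_m)`. -/
theorem w_eq_expSeq_or_point_of_rank_le_one {m : ℕ} (hm : 1 ≤ m) {q : ℕ → K} (h : (hankel1 K m 1 q).rank ≤ 1) :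
    (∃ A lam : K, w K m m q = w K m m (expSeq K A lam)) ∨ w K m m q = w K m m (ppSeq K m 0 (q m)) := by
  rcases (rank_hankel1_one_le_one_iff K hm q).mp h with ⟨A, lam, hq⟩ | hq
  · exact Or.inl ⟨A, lam, w_eq_w_expSeq K hq⟩
  · exact Or.inr (w_eq_w_ppSeq K hm hq)

/-- the Hankel matrices agree too: in the exponential case `H_k(q) = H_k(Aλ^•)` for every `k ≤ m` … -/
theorem hankel1_eq_hankel1_expSeq {m k : ℕ} (hk : k ≤ m) {q : ℕ → K} {A lam : K} (hq : ∀ j ≤ m, q j = A * lam ^ j) :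
    hankel1 K m k q = hankel1 K m k (expSeq K A lam) :=
  hankel1_eq_of_agree hk fun i hi => by rw [hq i hi, expSeq_apply]

/-- … and in the point case `H_k(q) = H_k(0, …, 0, q_m)` (`k ≤ m`, `m ≥ 1`). -/
theorem hankel1_eq_hankel1_ppSeq {m k : ℕ} (hm : 1 ≤ m) (hk : k ≤ m) {q : ℕ → K} (hq : ∀ j < m, q j = 0) :
    hankel1 K m k q = hankel1 K m k (ppSeq K m 0 (q m)) :=
  hankel1_eq_of_agree hk fun i hi => by
    rw [ppSeq]
    by_cases him : i = m
    · rw [him, if_pos rfl, if_neg (by omega), zero_add]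
    · rw [hq i (by omega), if_neg him, ite_self, add_zero]

end Summit.Ventures.HSemireg.Wedge.HankelRankOne
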